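import Summits.HodgeConjecture.HodgeConjecture.Cruxes.BlochSeedDiscOne.SeedCheckerSplitBlockCFree

/-!
line stmt-HodgeConjecture-18881 Cruxes/BlochSeedDiscOne/Lines/birth.lean 814a6a70c14e831a stub_rung_pad4_seedAt

# SplitBlockClassRows — the registered law-free row stub `SplitBlock.stub_classRows` of `Lines/splitblock.lean` v2
# (sha16 ab08aaed15d375b0; item stmt-HodgeConjecture-18881, line #2 `splitblock`), PROVED, with the json ↔ letter-model
# DICTIONARY under `SeedChecker.Design.shadow` it rests on (hsemireg-sheaf8-1 g10, 2026-08-31; R-B custody instrument seat; v1.1 = v1.0 + two docstrings)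

WHAT IS PROVED (sorry-free, std axioms; nothing here is toward the crux — see the honest register):

§1 THE DICTIONARY `Design.shadow` ↔ `Design.wch` (v41 §41.2 proved it per symbol ∕ per cell: `coef_shadowLetter`,
   `cellCoef_shadowCell`; this file lifts it to DESIGNS): for a POSITIVE design (`Design.Positive`: multiplicities `≥ 1` on the support —
   what makes `Int.toNat` in `Design.shadow` faithful; designs of record and both doors' guards carry it),
   * `shadow_T`    : `D.shadow.T w = D.wch (liftWord w)` for every letter-model word `w`;
   * `shadow_mu`   : `D.shadow.mu = D.mu`;
   * `shadow_rank` : `((D.shadow.rank : ℤ) : ℤ[i]) = D.rank` (`shadow_rank_eq`: `= Σ m_N − Σ m_P`);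
   * `shadow_A1_of_clean` : `D.Clean → D.shadow.A1` — the tree's class screen `ClassScreen` (on `CWord = Fin 4 → Fin 6`,
     letters `1,u,v,e,ē,p`) implies the letter model's `(A1)` (on `Word = Fin 4 → Sym`, symbols `1,h,e,ē,pt`) through the
     symbol dictionary `liftSym` (`h ↦ u`): `liftWord` preserves e-freeness and degree, is injective, and sends `eeee ↦ eWord`,
     `ēēēē ↦ ebarWord` (`efree_liftWord_iff`, `wdeg_liftWord`, `liftWord_injective`, `liftWord_eeee`, `liftWord_EEEE`).
   (The converse `A1 → Clean` is NOT claimed: `liftWord` misses the letter `v`; the row of record is the letter-model `A1`.)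
§2 C0 OF THE PADDED CLASS DESIGN READ BACK ON THE SHELL: `(D.padApexUp c k).Clean → D.Clean` (`clean_of_padApexUp_clean`,
   converse of v8 `padApexUp_clean`: the apex cell is (A1)-neutral), and for a C-free split-block datum `δ₀` that PASSES:
   `δ₀.Dsh.Clean`, `δ₀.Dsh.mu ≠ 0`, `δ₀.Dsh.rank = 4 + k` (`SplitBlockDatum₀.Passes.shell_clean ∕ shell_mu_ne_zero ∕ shell_rank`).
§3 THE STUB, VERBATIM SIGNATURE: `stub_classRows` — for every CM anchor and every C-free split-block datum with positive shell which
   passes (scope carried, unused): `δ.Dsh.shadow.A1 ∧ δ.Dsh.shadow.mu ≠ 0 ∧ 4 ≤ δ.Dsh.shadow.rank`; and the repackaging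
   `rung2b₀With_classRows : Rung2b₀With 14 (A1 ∧ μ ≠ 0 ∧ 4 ≤ rank)` (= `Lines/splitblock.lean` §3's, now unconditional) together
   with the height-free form `rung2b₀With_classRows_any h` and the law-guarded form `rung2b₀Under_classRows Λ h`.  The CM hypotheses and
   the scope rows are NOT used (`classRows_of_passes` states the minimal form: positive shell + `Passes`).
§4 THE SHEAF-DOOR TWIN (line `sheafdoor` of № 3′, stmt-HodgeConjecture-30548, `ShadowRows₀`'s class conjuncts): for a v41 core
   `δ : SplitBlockCore C E₀ ψ₀` with positive shell passing the rank-free sheaf door in ANY window (`δ.PassesSheaf I`):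
   `δ.Dsh.shadow.A1 ∧ δ.Dsh.shadow.mu ≠ 0` (`SplitBlockCore.classRows_of_passesSheaf`), law-free, C entering only through the door's
   own `ClassDataRankFree` conjunct.  The THIRD class conjunct `4 ≤ rank` of `ShadowRows₀` is NOT json on the sheaf door (the rank-free
   checker drops `rank = 4`; `rank (shadow) = rank 𝓔` needs `ch₀ = rank` and `cᵢ = 0 (i > rank)` for the cokernel bundle — geometry, not
   dictionary) and is NOT claimed here.

HONEST REGISTER.  A dictionary between two json models of the same letter arithmetic plus bookkeeping of C0 under apex padding.  It
closes the OFF-PATH registered stub `stub_classRows` of line #2 (a row of the kill path's guard), nothing else: `stub_rung2a`, the four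
tied row stubs, `BlochSeedDiscOne` (18881), `SheafSeedGaussSq` (30548), H2, HC_AV, HC_CM, HC are exactly as open as before; no datum,
block, sheaf or seed is constructed; letters ≠ sheaves ≠ SEED; typed ≠ proved.  No `sorry`, no `axiom`, no `instance`, no notation,
no `set_option allowUnsafeReducibility`.
-/

noncomputable section

set_option linter.dupNamespace false
set_option autoImplicit false

open CategoryTheory AlgebraicGeometry
open Literature.AlgebraicGeometry Literature.AlgebraicGeometry.Motives Literature.AlgebraicGeometry.HodgeTheory
open Literature.AlgebraicTopology.SingularHomology

namespace Summit.HodgeConjecture.HodgeConjecture.Cruxes.BlochSeedDiscOne.SeedChecker.SplitBlock.ClassRows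

open Summit.HodgeConjecture.HodgeConjecture.Cruxes.BlochSeedDiscOne.Anchor
open Summit.Ventures.HSemireg Summit.Ventures.HSemireg.Pad4Tower
open Summit.HodgeConjecture.HodgeConjecture.Cruxes.BlochSeedDiscOne.SeedChecker
open Summit.HodgeConjecture.HodgeConjecture.Cruxes.BlochSeedDiscOne.SeedChecker.SplitBlock

/-! ## §1 The dictionary `Design.shadow` ↔ `Design.wch` -/

section Symbols

/-- `liftSym` preserves degrees (`deg 1,h,e,ē,pt = 0,1,1,1,2` = `ldeg 0,1,3,4,5`). -/
theorem ldeg_liftSym (s : DepthBoundA4.Sym) : ldeg (liftSym s) = s.deg := by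
  cases s <;> rfl

/-- `liftSym s` is an `e`-letter (`3` or `4`) iff `s` is not e-free. -/
theorem liftSym_efree_iff (s : DepthBoundA4.Sym) : (liftSym s ≠ 3 ∧ liftSym s ≠ 4) ↔ s.efree = true := by
  cases s <;> decide

/-- `liftSym` is injective. -/
theorem liftSym_injective : Function.Injective liftSym := by
  intro s t h
  cases s <;> cases t <;> first | rfl | exact absurd h (by decide)

/-- `liftWord` preserves the degree. -/
theorem wdeg_liftWord (w : DepthBoundA4.Word) : wdeg (liftWord w) = w.deg := by
  simp only [wdeg, liftWord, ldeg_liftSym, DepthBoundA4.Word.deg, Fin.sum_univ_four]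

/-- `liftWord w` is e-free iff `w` is. -/
theorem efree_liftWord_iff (w : DepthBoundA4.Word) : EFree (liftWord w) ↔ w.efree := by
  simp only [EFree, liftWord, liftSym_efree_iff, DepthBoundA4.Word.efree]

/-- `liftWord` is injective. -/
theorem liftWord_injective : Function.Injective liftWord := by
  intro w w' h
  funext f
  exact liftSym_injective (congrFun h f)

/-- `liftWord eeee = eWord`. -/
theorem liftWord_eeee : liftWord DepthBoundA4.Word.eeee = eWord := by
  funext f
  fin_cases f <;> rfl

/-- `liftWord ēēēē = ebarWord`. -/
theorem liftWord_EEEE : liftWord DepthBoundA4.Word.EEEE = ebarWord := by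
  funext f
  fin_cases f <;> rfl

/-- a word other than `eeee` does not lift to `eWord`. -/
theorem liftWord_ne_eWord {w : DepthBoundA4.Word} (hw : w ≠ DepthBoundA4.Word.eeee) : liftWord w ≠ eWord := by
  rw [← liftWord_eeee]
  exact fun h => hw (liftWord_injective h)

/-- a word other than `ēēēē` does not lift to `ebarWord`. -/
theorem liftWord_ne_ebarWord {w : DepthBoundA4.Word} (hw : w ≠ DepthBoundA4.Word.EEEE) : liftWord w ≠ ebarWord := by
  rw [← liftWord_EEEE]
  exact fun h => hw (liftWord_injective h)

end Symbols

section Dictionary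

/-- the cast `ℕ → ℤ[i]` of `m.toNat` is the cast `ℤ → ℤ[i]` of `m` for `m ≥ 0`. -/
theorem natCast_toNat_of_nonneg {m : ℤ} (hm : 0 ≤ m) : ((m.toNat : ℕ) : GaussianInt) = ((m : ℤ) : GaussianInt) := by
  rw [← Int.cast_natCast, Int.toNat_of_nonneg hm]

/-- **THE DICTIONARY, word by word**: the letter model's class tensor of the shadow IS the design tensor on the lifted word. -/
theorem shadow_T (D : Design) (hD : D.Positive) (w : DepthBoundA4.Word) : D.shadow.T w = D.wch (liftWord w) := by
  simp only [DepthBoundA4.Design.T, Design.shadow, List.map_map, Function.comp_def, cellCoef_shadowCell,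
    Finset.sum_map_toList]
  simp only [Design.wch, MConfig.wch, Pi.sub_apply, Finset.sum_apply, Pi.smul_apply]
  simp only [zsmul_eq_mul]
  congr 1
  · exact Finset.sum_congr rfl fun Z hZ => by rw [natCast_toNat_of_nonneg (hD.1 Z hZ).le]
  · exact Finset.sum_congr rfl fun P hP => by rw [natCast_toNat_of_nonneg (hD.2 P hP).le]

/-- **`μ(shadow) = μ(D)`.** -/
theorem shadow_mu (D : Design) (hD : D.Positive) : D.shadow.mu = D.mu := by
  rw [DepthBoundA4.Design.mu, shadow_T D hD, liftWord_eeee]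
  rfl

/-- **`rank(shadow) = Σ m_N − Σ m_P`** (as integers). -/
theorem shadow_rank_eq (D : Design) (hD : D.Positive) :
    D.shadow.rank = ∑ Z ∈ D.cfg.lower, D.mN Z - ∑ P ∈ D.cfg.upper, D.mP P := by
  simp only [DepthBoundA4.Design.rank, Design.shadow, List.map_map, Function.comp_def, Finset.sum_map_toList,
    Nat.cast_sum]
  congr 1
  · exact Finset.sum_congr rfl fun Z hZ => Int.toNat_of_nonneg (hD.1 Z hZ).le
  · exact Finset.sum_congr rfl fun P hP => Int.toNat_of_nonneg (hD.2 P hP).le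

/-- **`rank(shadow) = rank(D)`** (the design's rank is the Gaussian integer `Σ m_N − Σ m_P`, `Design.rank_eq`). -/
theorem shadow_rank (D : Design) (hD : D.Positive) : ((D.shadow.rank : ℤ) : GaussianInt) = D.rank := by
  rw [shadow_rank_eq D hD, Design.rank_eq]

/-- **THE CLASS SCREEN IMPLIES (A1) OF THE SHADOW.** -/
theorem shadow_A1_of_clean (D : Design) (hD : D.Positive) (hc : D.Clean) : D.shadow.A1 := by
  refine ⟨fun w hw he hE => ?_, fun w w' hw hw' hdeg => ?_⟩
  · rw [shadow_T D hD]
    exact hc.1 (liftWord w) (fun h => hw ((efree_liftWord_iff w).1 h)) (liftWord_ne_eWord he) (liftWord_ne_ebarWord hE)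
  · rw [shadow_T D hD, shadow_T D hD]
    exact hc.2 (liftWord w) (liftWord w') ((efree_liftWord_iff w).2 hw) ((efree_liftWord_iff w').2 hw')
      (by rw [wdeg_liftWord, wdeg_liftWord, hdeg])

end Dictionary

/-! ## §2 C0 of the padded class design, read back on the shell design -/

section PadBack

/-- **the shell is (A1)-clean if its apex padding is** (converse of `Design.padApexUp_clean`: `T(D) = T(D↑) + k·ch(apex c)` and the
apex cell is (A1)-neutral). -/
theorem clean_of_padApexUp_clean (D : Design) (c k : ℤ) (h : (D.padApexUp c k).Clean) : D.Clean := by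
  have hT : D.wch = (D.padApexUp c k).wch + k • (apexCell c).ch := by
    rw [Design.wch_padApexUp, sub_add_cancel]
  rw [Design.Clean, hT]
  exact classScreen_add h (classScreen_zsmul (classScreen_apexCell c) k)

variable {E₀ : AbelianVariety ℂ} {ψ₀ : E₀ ⟶ E₀}

/-- C0 of the class design of a passing C-free datum. -/
theorem classData_of_passes (δ : SplitBlockDatum₀ E₀ ψ₀) (h : δ.Passes) : (δ.Dsh.padApexUp 0 δ.k).ClassData := by
  obtain ⟨⟨q, hq⟩, _⟩ := h
  exact hq.1

/-- a passing C-free datum has (A1)-CLEAN shell design. -/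
theorem shell_clean_of_passes (δ : SplitBlockDatum₀ E₀ ψ₀) (h : δ.Passes) : δ.Dsh.Clean :=
  clean_of_padApexUp_clean δ.Dsh 0 δ.k (classData_of_passes δ h).1

/-- a passing C-free datum has shell design with `μ ≠ 0`. -/
theorem shell_mu_ne_zero_of_passes (δ : SplitBlockDatum₀ E₀ ψ₀) (h : δ.Passes) : δ.Dsh.mu ≠ 0 := by
  have hμ := (classData_of_passes δ h).2.1
  rwa [Design.padApexUp_mu] at hμ

/-- a passing C-free datum has shell design of rank `4 + k`. -/
theorem shell_rank_of_passes (δ : SplitBlockDatum₀ E₀ ψ₀) (h : δ.Passes) : δ.Dsh.rank = 4 + ((δ.k : ℤ) : GaussianInt) := by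
  have hr := (classData_of_passes δ h).2.2.1
  rw [Design.padApexUp_rank] at hr
  rw [← hr, sub_add_cancel]

/-- … hence its shadow has integer rank `4 + k` (positive shell). -/
theorem shadow_rank_of_passes (δ : SplitBlockDatum₀ E₀ ψ₀) (hD : δ.Dsh.Positive) (h : δ.Passes) :
    δ.Dsh.shadow.rank = 4 + (δ.k : ℤ) := by
  have h1 := shadow_rank δ.Dsh hD
  rw [shell_rank_of_passes δ h] at h1
  have h2 := congrArg Zsqrtd.re h1
  simp only [Zsqrtd.re_intCast, Zsqrtd.re_add, Zsqrtd.re_ofNat] at h2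
  omega

end PadBack

/-! ## §3 The registered stub `stub_classRows`, verbatim, and its repackagings -/

section Stub

variable {E₀ : AbelianVariety ℂ} {ψ₀ : E₀ ⟶ E₀}

/-- **THE CLASS ROWS, minimal form**: positive shell + `Passes` ⟹ `A1 ∧ μ ≠ 0 ∧ 4 ≤ rank` of the shadow.  No CM hypothesis, no scope
row, no law is used. -/
theorem classRows_of_passes (δ : SplitBlockDatum₀ E₀ ψ₀) (hD : δ.Dsh.Positive) (h : δ.Passes) :
    δ.Dsh.shadow.A1 ∧ δ.Dsh.shadow.mu ≠ 0 ∧ 4 ≤ δ.Dsh.shadow.rank := by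
  refine ⟨shadow_A1_of_clean δ.Dsh hD (shell_clean_of_passes δ h), ?_, ?_⟩
  · rw [shadow_mu δ.Dsh hD]
    exact shell_mu_ne_zero_of_passes δ h
  · rw [shadow_rank_of_passes δ hD h]
    omega

/-- **THE REGISTERED STUB `SplitBlock.stub_classRows` OF `Lines/splitblock.lean` v2 (ab08aaed15d375b0), VERBATIM SIGNATURE — PROVED.**
For every CM anchor and every C-free split-block datum with positive shell which passes (scope carried for the uniform F6 shape, unused):
the shell SHADOW is (A1)-clean in the letter model, has `μ ≠ 0`, and rank `≥ 4`.  Route exactly as the stub's docstring: `Passes.1` gives C0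
of `Dsh.padApexUp 0 k`; `padApexUp_mu`, `padApexUp_rank` (`rank Dsh = 4 + k`), cleanness of `Dsh` from that of the padded design (the
apex cell is (A1)-neutral); then the json ↔ letter-model dictionary under `Design.shadow` (`shadow_T`, `Int.toNat` faithful by positivity)
transports `Clean ↦ A1`, `mu ↦ mu`, `rank ↦ rank`.  [cite: Fulton1998, Example 3.2.3] -/
theorem stub_classRows :
    ∀ (E₀ : AbelianVariety ℂ) (ψ₀ : E₀ ⟶ E₀), E₀.dim = 1 → ψ₀ ≫ ψ₀ = -(1 • 𝟙 E₀) →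
      ∀ δ : SplitBlockDatum₀ E₀ ψ₀, δ.Dsh.Positive → δ.Passes → ScopeRows 14 δ.Dsh.shadow →
        δ.Dsh.shadow.A1 ∧ δ.Dsh.shadow.mu ≠ 0 ∧ 4 ≤ δ.Dsh.shadow.rank :=
  fun _ _ _ _ δ hpos hpass _ => classRows_of_passes δ hpos hpass

/-- the class rows as the law-free scope-guarded 2b₀ at height `14` (= `Lines/splitblock.lean` §3 `rung2b₀With_classRows`, now
unconditional). -/
theorem rung2b₀With_classRows : Rung2b₀With 14 fun D' => D'.A1 ∧ D'.mu ≠ 0 ∧ 4 ≤ D'.rank :=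
  fun E₀ ψ₀ hE hψ δ _ hpos hpass hscope => stub_classRows E₀ ψ₀ hE hψ δ hpos hpass hscope

/-- … at every height `h` (the scope row is not used). -/
theorem rung2b₀With_classRows_any (h : ℤ) : Rung2b₀With h fun D' => D'.A1 ∧ D'.mu ≠ 0 ∧ 4 ≤ D'.rank :=
  fun _ _ _ _ δ _ hpos hpass _ => classRows_of_passes δ hpos hpass

/-- … and under every law `Λ` (a law only adds an antecedent). -/
theorem rung2b₀Under_classRows (Λ : DatumLaw) (h : ℤ) : Rung2b₀Under Λ h fun D' => D'.A1 ∧ D'.mu ≠ 0 ∧ 4 ≤ D'.rank :=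
  fun _ _ _ _ δ _ hpos hpass _ => classRows_of_passes δ hpos hpass

end Stub

/-! ## §4 The sheaf-door twin (line `sheafdoor`, stmt-HodgeConjecture-30548): the two json class conjuncts of `ShadowRows₀` -/

section SheafDoor

variable {E₀ : AbelianVariety ℂ} {ψ₀ : E₀ ⟶ E₀} {C : ChernCharacterBetti}

/-- the rank-free sheaf door's own C0′ conjunct: a core passing the sheaf door in the window `I` has `ClassDataRankFree` shell
(`Clean ∧ μ ≠ 0`). [unfolding `Design.SheafSeedCheckRankFree`] -/
theorem _root_.Summit.HodgeConjecture.HodgeConjecture.Cruxes.BlochSeedDiscOne.SeedChecker.SplitBlock.SplitBlockCore.classDataRankFree_of_passesSheaf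
    (δ : SplitBlockCore C E₀ ψ₀) {I : Finset ℕ} (h : δ.PassesSheaf I) : δ.Dsh.ClassDataRankFree :=
  h.1

/-- **THE SHEAF-DOOR CLASS ROWS (law-free)**: a v41 split-block core through ANY theory `C`, with positive shell, passing the rank-free
sheaf door in ANY window, has (A1)-clean shadow with `μ ≠ 0` — the first two class conjuncts of
`SplitBlock.ShadowRows₀` for line `sheafdoor`'s STUB 2 ∕ STUB 3.  (`4 ≤ rank` is NOT json on this door and is not claimed.) -/
theorem _root_.Summit.HodgeConjecture.HodgeConjecture.Cruxes.BlochSeedDiscOne.SeedChecker.SplitBlock.SplitBlockCore.classRows_of_passesSheaf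
    (δ : SplitBlockCore C E₀ ψ₀) (hD : δ.Dsh.Positive) {I : Finset ℕ} (h : δ.PassesSheaf I) :
    δ.Dsh.shadow.A1 ∧ δ.Dsh.shadow.mu ≠ 0 := by
  obtain ⟨hc, hμ⟩ := δ.classDataRankFree_of_passesSheaf h
  refine ⟨shadow_A1_of_clean δ.Dsh hD hc, ?_⟩
  rw [shadow_mu δ.Dsh hD]
  exact hμ

/-- the same in the guard shape of `SplitBlock.Rung2bSheaf₀With` (law-free scope-guarded sheaf 2b), every `C`, `I`, `h`. -/
theorem rung2bSheaf₀With_classRows (C : ChernCharacterBetti) (I : Finset ℕ) (h : ℤ) :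
    Rung2bSheaf₀With C I h fun D' => D'.A1 ∧ D'.mu ≠ 0 :=
  fun _ _ _ _ δ _ hpos hδ _ => δ.classRows_of_passesSheaf hpos hδ

end SheafDoor

/-! ## Audit -/

/-- AUDIT: closes the off-path registered stub `stub_classRows` of line #2 and two json conjuncts of line `sheafdoor`'s rows; decides
nothing about `BlochSeedDiscOne` (18881), `SheafSeedGaussSq` (30548), H2, HC_AV, HC_CM, № 4, 26512 or HC. -/
theorem audit_nothing_decided : True := trivial

end Summit.HodgeConjecture.HodgeConjecture.Cruxes.BlochSeedDiscOne.SeedChecker.SplitBlock.ClassRows
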